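import Summits.BirchSwinnertonDyer.BirchSwinnertonDyer.Theses.RamifiedHeegnerPair
import Summits.BirchSwinnertonDyer.Rank1Residual.X11b.CongruentSelmerTransfer

/-!
# Line `unitswitch` for crux U₁ = `RamifiedHeegnerPair.LeafRankOneUpperAtThree` (item 26022)

Crux-ideate seat 1 gen 4 (planner), 2026-08-30. Skeleton of the idea card `Ideas/unitswitch.md`:
HABITAT SPLIT by the 3-adic unit condition on `#Ш_an` (tree idiom `hv : padicValRat p q = 0`),
and on the unit habitat a ONE-PLACE INDEX EXCHANGE to a rank-0 Selmer structure that differs from the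
Kummer structure of `E[3]` at ONE Tamagawa-3 carrier (realised — outside this file — by the optimal
quotient of a newform congruent to `f_E` mod `𝔭 ∣ 3` and LEVEL-LOWERED at that carrier, bounded by
Kato). Four stubs + the kernel-checked composition `LeafRankOneUpperAtThree_of` (which also takes the
route's PRINT item PUB⁺ = `LeafRankOnePrintedInputsAtThree`, item 27491, BY NAME, as `closes` does).
Nothing here is proved except the composition; BSD is proved for no curve here; typed ≠ proved.
-/

noncomputable section

open scoped Classical

open NumberField IsDedekindDomain WeierstrassCurve
open Literature.NumberTheory.EllipticCurves
open Literature.NumberTheory.EllipticCurves.Rank1Residual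
open Literature.NumberTheory.GaloisRepresentations
open Literature.NumberTheory.GaloisRepresentations.DiscreteGaloisModule (SelmerStructure)
open Literature.NumberTheory.GaloisCohomology

namespace Summit.BirchSwinnertonDyer.BirchSwinnertonDyer.Cruxes.LeafRankOneUpperAtThree.Unitswitch

/- Hab₁(W) («unit habitat»): `∃ q : ℚ, shaAn W = (q : ℂ) ∧ padicValRat 3 q = 0` — the analytic order of
   Ш is a 3-adic UNIT (the tree's `hunit`/`hv` idiom of the rank-0 Kato lanes, here on the rank-1 leaf;
   decidable per curve; holds on all 33 residue rows of the crux, IDEATION-BRIEF §2). Spelled INLINE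
   below so that no untagged `def … : Prop` enters the file. -/

/-- STUB 1 (pure Galois-cohomology bookkeeping, ATTACKABLE): for ANY Selmer structure `𝓐` on `E[3]`
agreeing with the Kummer structure off one finite place `ℓ`, the strict-at-`ℓ` Kummer Selmer group
sits inside `Sel(𝓐)`, whence `#Sel₃(E) ≤ #𝓚_ℓ · #Sel(𝓐)` (`𝓚_ℓ` = local Kummer condition at `ℓ`). -/
theorem stub_onePlaceIndex :
    ∀ (W : WeierstrassCurve ℚ) [W.IsElliptic]
      (𝓐 : SelmerStructure (W.torsionGaloisModule (3 : ℤ))) (ℓ : HeightOneSpectrum (𝓞 ℚ)),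
      (∀ v ≠ (Sum.inr ℓ : Place ℚ), 𝓐 v = W.kummerSelmerStructure (3 : ℤ) v) →
      Nat.card ((W.kummerSelmerStructure (3 : ℤ)).selmerGroup) ≤
        Nat.card (W.kummerSelmerStructure (3 : ℤ) (Sum.inr ℓ)) * Nat.card 𝓐.selmerGroup := by
  sorry

/-- STUB 2 (descent bookkeeping, ATTACKABLE; the PRINT inputs of the route's PUB⁺ item 27491 — here only
`rank_eq_analyticRank_of_analyticRank_le_one` (GZK) is used — enter as the first hypothesis, exactly as
`hP` enters the route's `closes`): on the rank-one leaf, `#Sel₃(E) ≤ 3` forces `Ш(E)[3] = 0`, i.e.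
`3 ∤ #Ш(E)` (`E(ℚ)/3E(ℚ)` of order `≥ 3` already fills `Sel₃`; `W.shaOrder = 0` if `Ш` is infinite, so
the conclusion is `padicValNat 3 W.shaOrder = 0` either way). -/
theorem stub_selmerCardToSha :
    Summit.BirchSwinnertonDyer.BirchSwinnertonDyer.Theses.RamifiedHeegnerPair.LeafRankOnePrintedInputsAtThree →
    ∀ (W : WeierstrassCurve ℚ) [W.IsElliptic] [W.IsGloballyMinimal], ¬ W.HasCM → Addv W 3 →
      Summit.BirchSwinnertonDyer.Rank1Residual.Additive.SubGss W 3 → W.analyticRank = 1 →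
      Nat.card ((W.kummerSelmerStructure (3 : ℤ)).selmerGroup) ≤ 3 →
      padicValNat 3 W.shaOrder = 0 := by
  sorry

/-- STUB 3 (THE RESEARCH LEAF «unit partner», IDEA-NEEDED; BSD-equivalent on the unit habitat to
`Ш(E)[3] = 0`): on the unit habitat there is a Selmer structure on `E[3]` that agrees with the Kummer
structure off ONE finite place `ℓ` with `#𝓚_ℓ ≤ 3` and has TRIVIAL Selmer group. Intended witness:
`ℓ` = a Tamagawa-3 carrier off which the Mordell–Weil generator sits, `𝓐` = the mod-`𝔭` Bloch–Kato
structure of the optimal quotient `A_g` of a newform `g ≡ f_E (mod 𝔭)`, LEVEL-LOWERED at `ℓ`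
(unramified line at `ℓ`; the same isotropic line everywhere else), `Sel(𝓐) = 0` by Kato's bound for
`g` from `ord_𝔭 (L(g,1)/Ω_g) ≤ 1` (NONDIV, the class-wide open input) and Cassels–Tate parity. -/
theorem stub_unitPartner :
    ∀ (W : WeierstrassCurve ℚ) [W.IsElliptic] [W.IsGloballyMinimal], ¬ W.HasCM → Addv W 3 →
      Summit.BirchSwinnertonDyer.Rank1Residual.Additive.SubGss W 3 → W.analyticRank = 1 →
      (∃ q : ℚ, shaAn W = (q : ℂ) ∧ padicValRat 3 q = 0) →
      ∃ (𝓐 : SelmerStructure (W.torsionGaloisModule (3 : ℤ))) (ℓ : HeightOneSpectrum (𝓞 ℚ)),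
        (∀ v ≠ (Sum.inr ℓ : Place ℚ), 𝓐 v = W.kummerSelmerStructure (3 : ℤ) v) ∧
        Nat.card (W.kummerSelmerStructure (3 : ℤ) (Sum.inr ℓ)) ≤ 3 ∧
        Nat.card 𝓐.selmerGroup = 1 := by
  sorry

/-- STUB 4 (RESIDUAL off the unit habitat, fed by the route's Σ★⁸ / rank-0 half; EMPTY known support
on the 33 residue rows): U₁ for leaf curves whose `#Ш_an` is NOT a `3`-adic unit. -/
theorem stub_offUnitHabitat :
    ∀ (W : WeierstrassCurve ℚ) [W.IsElliptic] [W.IsGloballyMinimal], ¬ W.HasCM → Addv W 3 →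
      Summit.BirchSwinnertonDyer.Rank1Residual.Additive.SubGss W 3 → W.analyticRank = 1 →
      ¬ (∃ q : ℚ, shaAn W = (q : ℂ) ∧ padicValRat 3 q = 0) → Typed.MissingUpperBoundAt W 3 := by
  sorry

/-- COMPOSITION (kernel-checked, no `sorry`): the route's PRINT item PUB⁺ (27491, by name, as `hP` in
the route's `closes`) and the four stubs give the crux BY NAME. -/
theorem LeafRankOneUpperAtThree_of
    (hP : Summit.BirchSwinnertonDyer.BirchSwinnertonDyer.Theses.RamifiedHeegnerPair.LeafRankOnePrintedInputsAtThree)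
    (h1 : ∀ (W : WeierstrassCurve ℚ) [W.IsElliptic]
      (𝓐 : SelmerStructure (W.torsionGaloisModule (3 : ℤ))) (ℓ : HeightOneSpectrum (𝓞 ℚ)),
      (∀ v ≠ (Sum.inr ℓ : Place ℚ), 𝓐 v = W.kummerSelmerStructure (3 : ℤ) v) →
      Nat.card ((W.kummerSelmerStructure (3 : ℤ)).selmerGroup) ≤
        Nat.card (W.kummerSelmerStructure (3 : ℤ) (Sum.inr ℓ)) * Nat.card 𝓐.selmerGroup)
    (h2 : Summit.BirchSwinnertonDyer.BirchSwinnertonDyer.Theses.RamifiedHeegnerPair.LeafRankOnePrintedInputsAtThree →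
      ∀ (W : WeierstrassCurve ℚ) [W.IsElliptic] [W.IsGloballyMinimal], ¬ W.HasCM → Addv W 3 →
      Summit.BirchSwinnertonDyer.Rank1Residual.Additive.SubGss W 3 → W.analyticRank = 1 →
      Nat.card ((W.kummerSelmerStructure (3 : ℤ)).selmerGroup) ≤ 3 →
      padicValNat 3 W.shaOrder = 0)
    (h3 : ∀ (W : WeierstrassCurve ℚ) [W.IsElliptic] [W.IsGloballyMinimal], ¬ W.HasCM → Addv W 3 →
      Summit.BirchSwinnertonDyer.Rank1Residual.Additive.SubGss W 3 → W.analyticRank = 1 →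
      (∃ q : ℚ, shaAn W = (q : ℂ) ∧ padicValRat 3 q = 0) →
      ∃ (𝓐 : SelmerStructure (W.torsionGaloisModule (3 : ℤ))) (ℓ : HeightOneSpectrum (𝓞 ℚ)),
        (∀ v ≠ (Sum.inr ℓ : Place ℚ), 𝓐 v = W.kummerSelmerStructure (3 : ℤ) v) ∧
        Nat.card (W.kummerSelmerStructure (3 : ℤ) (Sum.inr ℓ)) ≤ 3 ∧
        Nat.card 𝓐.selmerGroup = 1)
    (h4 : ∀ (W : WeierstrassCurve ℚ) [W.IsElliptic] [W.IsGloballyMinimal], ¬ W.HasCM → Addv W 3 →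
      Summit.BirchSwinnertonDyer.Rank1Residual.Additive.SubGss W 3 → W.analyticRank = 1 →
      ¬ (∃ q : ℚ, shaAn W = (q : ℂ) ∧ padicValRat 3 q = 0) → Typed.MissingUpperBoundAt W 3) :
    Summit.BirchSwinnertonDyer.BirchSwinnertonDyer.Theses.RamifiedHeegnerPair.LeafRankOneUpperAtThree := by
  intro W _ _ hCM hAdd hGss hr
  by_cases hab : ∃ q : ℚ, shaAn W = (q : ℂ) ∧ padicValRat 3 q = 0
  · obtain ⟨𝓐, ℓ, hagree, hK, hA⟩ := h3 W hCM hAdd hGss hr hab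
    have hidx := h1 W 𝓐 ℓ hagree
    have hsel : Nat.card ((W.kummerSelmerStructure (3 : ℤ)).selmerGroup) ≤ 3 := by
      calc Nat.card ((W.kummerSelmerStructure (3 : ℤ)).selmerGroup)
          ≤ Nat.card (W.kummerSelmerStructure (3 : ℤ) (Sum.inr ℓ)) * Nat.card 𝓐.selmerGroup := hidx
        _ ≤ 3 * 1 := Nat.mul_le_mul hK hA.le
        _ = 3 := by norm_num
    have h0 : padicValNat 3 W.shaOrder = 0 := h2 hP W hCM hAdd hGss hr hsel
    obtain ⟨q, hq, hv⟩ := hab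
    exact ⟨q, hq, by rw [h0, hv]; simp⟩
  · exact h4 W hCM hAdd hGss hr hab

end Summit.BirchSwinnertonDyer.BirchSwinnertonDyer.Cruxes.LeafRankOneUpperAtThree.Unitswitch

end
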